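import Summits.Schanuel.Schanuel.Theorems.RootDecomp1KHeightBoundary04
import Summits.Schanuel.Schanuel.Theorems.RootDecomp1KSiegelFunctions05

/-!
(census-1 g34 ×0 RECORD PORT — part 05 of the kernel scratch «EFFECTIVE GLUE»: INSTRUMENT OFFER 87 L3547 / NOTE 87 L3548;
crit-1 g15 PRICE + AUDIT + PORT GO L3549, terms r87-(i)–(xi); scratch = HOME/census/tools/gen34/effglue/HeightBoundary05.lean
sha256 dad08aeb5fc815cb079e5a31e7c197e1c7fe6c445116f65b4302d21ce183ed13 (169 l); this file = that scratch byte for byte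
below this provenance block (r87-(iii)); `--supports stmt-Schanuel-33364`, no `--cite`, no credit, no item decided; ×0;
rung 0.)
-/

/-!
# RootDecomp1KHeightBoundary (part 05: §13–§14) — census-1 g34 kernel scratch «EFFECTIVE GLUE», second file:
  READING THE BUDGETS of `EffSiegelFunctions` in naive heights, and the SATISFIABILITY PROBE on node 31's toy `parabP`
  (×0; no decision; rung 0)

* §13 `relConst_le_of_height` / `log_relConst_le_of_height`: if `T ≥ 1` bounds `|D|` and every coefficient of every
  `χ_i` (`deg χ_i ≤ a·i`), then `relConst m D χ ≤ 2·T·(1 + m·(a·m + 1)·T)` and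
  `log relConst m D χ ≤ log 2 + 2·log T + log (1 + m·(a·m + 1))` — budgets 1–2 of part 04's `EffSiegelFunctions P` ask only
  `log T_b = O(exp (B·b))` of the relations' naive heights `T_b`: DOUBLY exponential coefficient heights are admissible
  (what the boundary window of part 03 tolerates, read back through LEMMA H).
* §14 `effSiegelFunctions_parabP : EffSiegelFunctions parabP` — node 31's toy `Y² − x` (`siegelFunctions_parabP`) carries
  EFFECTIVE Siegel functions: `φ = 1 = G/H` with `G = H = 1` (relation `T − 1`), `ψ = Y^b` (relation
  `T² − x^b ≡ 0 mod (Y² − x)`), both constants `relConst = 4 ≤ exp (exp (2·b))`, and `G·H = 1` never vanishes (budget 3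
  vacuous) — the typed `∃` of part 04 is inhabited and its budgets mean what they say.

HONEST SCOPE.  ×0; no decision; `EffSiegelFunctions P` for a curve of positive genus (e.g. `W4`) is NOT proved anywhere in
the tree.  Nothing here proves Schanuel, 33364, 33363, 31077, 31987, `ThinFibre 2`, `ThinFibreAt 2 W4P` or
`LevelFinite W4P`.  Imports: part 04 and node 31's part 05 (the toy `parabP`, `relPoly_one/two`, `not_qdvd_one`).
No Literature import, no sorry, no set_option, no private, no instance, no notation.
-/

noncomputable section

namespace Summit.Schanuel.Schanuel.Theorems.RootDecomp1KHeightBoundary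

open Polynomial
open scoped Nat Polynomial.Bivariate
open Summit.Schanuel.Schanuel.Theorems.RootDecomp1KDegreeLadder
open Summit.Schanuel.Schanuel.Theorems.RootDecomp1KHeightGrading
open Summit.Schanuel.Schanuel.Theorems.RootDecomp1KSiegelFunctions

/-! ### §13  Reading budgets 1–2 in naive heights -/

/-- READING BUDGETS 1–2 IN TERMS OF THE NAIVE HEIGHT OF A RELATION (max |coefficient|): if `T ≥ 1` bounds `|D|` and
every coefficient of every `χ_i`, and `deg χ_i ≤ a·i`, then `relConst m D χ ≤ 2·T·(1 + m·(a·m + 1)·T)`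
(`‖χ_i‖₁ ≤ (deg χ_i + 1)·T ≤ (a·m + 1)·T` for `i ≤ m`). -/
theorem relConst_le_of_height {m a : ℕ} {D : ℤ} {χ : ℕ → ℤ[X]} {T : ℝ} (hT : 1 ≤ T) (hD : |(D : ℝ)| ≤ T)
    (hχ : ∀ i, (χ i).natDegree ≤ a * i) (hc : ∀ i j, |((χ i).coeff j : ℝ)| ≤ T) :
    relConst m D χ ≤ 2 * T * (1 + (m : ℝ) * ((a * m + 1 : ℕ) : ℝ) * T) := by
  have hT0 : 0 ≤ T := le_trans zero_le_one hT
  have hl1 : ∀ i ∈ Finset.Icc 1 m, l1 (χ i) ≤ ((a * m + 1 : ℕ) : ℝ) * T := by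
    intro i hi
    have him := (Finset.mem_Icc.mp hi).2
    have hdeg : (χ i).natDegree + 1 ≤ a * m + 1 := Nat.succ_le_succ ((hχ i).trans (Nat.mul_le_mul_left a him))
    unfold l1
    calc ∑ j ∈ Finset.range ((χ i).natDegree + 1), |((χ i).coeff j : ℝ)|
        ≤ ∑ j ∈ Finset.range ((χ i).natDegree + 1), T := Finset.sum_le_sum fun j _ => hc i j
      _ = (((χ i).natDegree + 1 : ℕ) : ℝ) * T := by rw [Finset.sum_const, Finset.card_range, nsmul_eq_mul]
      _ ≤ ((a * m + 1 : ℕ) : ℝ) * T := mul_le_mul_of_nonneg_right (by exact_mod_cast hdeg) hT0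
  have hsum : ∑ i ∈ Finset.Icc 1 m, l1 (χ i) ≤ (m : ℝ) * ((a * m + 1 : ℕ) : ℝ) * T := by
    calc ∑ i ∈ Finset.Icc 1 m, l1 (χ i) ≤ ∑ i ∈ Finset.Icc 1 m, ((a * m + 1 : ℕ) : ℝ) * T := Finset.sum_le_sum hl1
      _ = (m : ℝ) * ((a * m + 1 : ℕ) : ℝ) * T := by
          rw [Finset.sum_const, Nat.card_Icc, Nat.add_sub_cancel, nsmul_eq_mul]; ring
  have hmax : max 1 |(D : ℝ)| ≤ T := max_le hT hD
  have hmax0 : 0 ≤ max 1 |(D : ℝ)| := le_trans zero_le_one (le_max_left _ _)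
  have hS0 : 0 ≤ 1 + ∑ i ∈ Finset.Icc 1 m, l1 (χ i) :=
    add_nonneg zero_le_one (Finset.sum_nonneg fun i _ => l1_nonneg _)
  unfold relConst
  calc 2 * max 1 |(D : ℝ)| * (1 + ∑ i ∈ Finset.Icc 1 m, l1 (χ i))
      ≤ 2 * T * (1 + (m : ℝ) * ((a * m + 1 : ℕ) : ℝ) * T) :=
        mul_le_mul (by linarith) (by linarith) hS0 (by linarith)

/-- … hence `log relConst m D χ ≤ log 2 + 2·log T + log (1 + m·(a·m + 1))`: budgets 1–2 of `EffSiegelFunctions` ask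
`log T_b = O(exp (B·b))` of the relations' naive heights `T_b` — DOUBLY exponential coefficient heights are admissible. -/
theorem log_relConst_le_of_height {m a : ℕ} {D : ℤ} {χ : ℕ → ℤ[X]} {T : ℝ} (hT : 1 ≤ T) (hD : |(D : ℝ)| ≤ T)
    (hχ : ∀ i, (χ i).natDegree ≤ a * i) (hc : ∀ i j, |((χ i).coeff j : ℝ)| ≤ T) :
    Real.log (relConst m D χ) ≤ Real.log 2 + 2 * Real.log T + Real.log (1 + (m : ℝ) * ((a * m + 1 : ℕ) : ℝ)) := by
  have hT0 : 0 < T := lt_of_lt_of_le one_pos hT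
  set c : ℝ := (m : ℝ) * ((a * m + 1 : ℕ) : ℝ) with hcdef
  have hc0 : 0 ≤ c := by positivity
  have h1 := relConst_le_of_height (m := m) hT hD hχ hc
  have h2 : 2 * T * (1 + c * T) ≤ 2 * (T * T) * (1 + c) := by nlinarith
  have h3 : relConst m D χ ≤ 2 * (T * T) * (1 + c) := by rw [hcdef] at h2 ⊢; linarith
  calc Real.log (relConst m D χ) ≤ Real.log (2 * (T * T) * (1 + c)) :=
        Real.log_le_log (relConst_pos m D χ) h3
    _ = Real.log 2 + 2 * Real.log T + Real.log (1 + c) := by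
        rw [Real.log_mul (by positivity) (by positivity), Real.log_mul (by norm_num) (by positivity),
          Real.log_mul hT0.ne' hT0.ne']
        ring

/-! ### §14  Satisfiability probe: the toy `parabP = Y² − x` carries EFFECTIVE Siegel functions -/

/-- `‖−1‖₁ = 1` in `ℤ[x]`. -/
theorem l1_neg_one : l1 (-1 : ℤ[X]) = 1 := by
  unfold l1
  have h : (-1 : ℤ[X]).natDegree = 0 := by rw [natDegree_neg, natDegree_one]
  rw [h, Finset.sum_range_one, coeff_neg, coeff_one_zero]
  simp

/-- `‖0‖₁ = 0`. -/
theorem l1_zero : l1 (0 : ℤ[X]) = 0 := by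
  unfold l1; simp

/-- `‖−x^b‖₁ = 1`. -/
theorem l1_neg_X_pow (b : ℕ) : l1 (-X ^ b : ℤ[X]) = 1 := by
  unfold l1
  rw [natDegree_neg, natDegree_X_pow]
  simp only [coeff_neg, coeff_X_pow, Int.cast_neg]
  rw [Finset.sum_eq_single b]
  · simp
  · intro j _ hj; simp [hj]
  · intro h; exact absurd (Finset.mem_range.mpr (Nat.lt_succ_self b)) h

/-- the constant of the relation `T − 1` (`m = 1`, `D = 1`, `χ₁ = −1`): `relConst = 4`. -/
theorem relConst_rel_one : relConst 1 1 (fun i => if i = 0 then 0 else -(1 : ℤ[X])) = 4 := by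
  unfold relConst
  have h : ∑ i ∈ Finset.Icc 1 1, l1 ((fun i => if i = 0 then 0 else -(1 : ℤ[X])) i) = 1 := by
    rw [show Finset.Icc 1 1 = ({1} : Finset ℕ) from rfl, Finset.sum_singleton]
    simp [l1_neg_one]
  rw [h]; norm_num

/-- the constant of the relation `T² − x^b` (`m = 2`, `D = 1`, `χ₂ = −x^b`, `χ₁ = 0`): `relConst = 4`. -/
theorem relConst_rel_sq (b : ℕ) : relConst 2 1 (fun i => if i = 2 then -(X ^ b : ℤ[X]) else 0) = 4 := by
  unfold relConst
  have h : ∑ i ∈ Finset.Icc 1 2, l1 ((fun i => if i = 2 then -(X ^ b : ℤ[X]) else 0) i) = 1 := by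
    rw [Icc_one_two, Finset.sum_pair (by norm_num)]
    simp [l1_zero, l1_neg_X_pow]
  rw [h]; norm_num

/-- `log 4 ≤ exp (2·b)` for `b ≥ 1` (`log 4 ≤ 3 ≤ 1 + 2b ≤ exp (2b)`). -/
theorem log_four_le_exp {b : ℕ} (hb : 1 ≤ b) : Real.log 4 ≤ Real.exp (2 * (b : ℝ)) := by
  have hb' : (1 : ℝ) ≤ b := by exact_mod_cast hb
  have h1 : Real.log 4 ≤ 4 - 1 := Real.log_le_sub_one_of_pos (by norm_num)
  have h2 : 2 * (b : ℝ) + 1 ≤ Real.exp (2 * (b : ℝ)) := Real.add_one_le_exp _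
  linarith

/-- **`EffSiegelFunctions (Y² − x)` PROVED** (`c₀ = 1`, `B = 2`; for `b ≥ 1`: `a = ⌈b/2⌉`, `φ = 1 = G/H` with `G = H = 1`
(relation `T − 1`), `ψ = Y^b` (relation `T² − x^b ≡ 0 mod (Y² − x)`); both constants `relConst = 4`, `log 4 ≤ exp (2b)`;
`G·H = 1` never vanishes, so budget 3 is vacuous) — the typed `∃` of §10 is inhabited and its budgets mean what they say. -/
theorem effSiegelFunctions_parabP : EffSiegelFunctions parabP := by
  have hn : 1 ≤ parabP.natDegree := by rw [natDegree_parabP]; norm_num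
  refine ⟨1, 2, fun b hb => ⟨(b + 1) / 2, 1, 1, 1, 1, fun i => if i = 0 then 0 else -(1 : ℤ[X]), 2, 1,
    fun i => if i = 2 then -(X ^ b : ℤ[X]) else 0, ?_, not_qdvd_one hn, not_qdvd_one hn, ⟨one_ne_zero, ?_, ?_⟩,
    ⟨one_ne_zero, ?_, ?_⟩, ?_, ?_, ?_⟩⟩
  · rw [natDegree_parabP, xdeg_parabP]; omega
  · intro i
    dsimp only
    split_ifs with h
    · simp
    · rw [natDegree_neg, natDegree_one]; exact Nat.zero_le _
  · have h0 : relPoly 1 1 (fun i => if i = 0 then 0 else -(1 : ℤ[X])) 1 1 = 0 := by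
      rw [relPoly_one]; simp
    unfold QDvd
    rw [h0, ratModel_zero]
    exact dvd_zero _
  · intro i
    dsimp only
    split_ifs with h
    · subst h; rw [natDegree_neg, natDegree_X_pow]; omega
    · simp
  · have hrel : relPoly 2 1 (fun i => if i = 2 then -(X ^ b : ℤ[X]) else 0) (1 * X ^ b) 1 =
        (X ^ 2) ^ b - C X ^ b := by
      rw [relPoly_two]; simp; ring
    unfold QDvd
    rw [hrel]
    simp only [parabP, ratModel_sub, ratModel_pow, ratModel_X, ratModel_C, Polynomial.map_X]
    exact sub_dvd_pow_sub_pow _ _ b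
  · rw [relConst_rel_one]; exact log_four_le_exp hb
  · rw [relConst_rel_sq]; exact log_four_le_exp hb
  · intro x y _ h1
    rw [mul_one, bev_one] at h1
    exact absurd h1 one_ne_zero

end Summit.Schanuel.Schanuel.Theorems.RootDecomp1KHeightBoundary

end
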